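import Mathlib
import Literature.MathematicalPhysics.QuantumLattice.FinDimSpectrum
import Literature.MathematicalPhysics.QuantumLattice.FockRelabel
import Summits.HubbardSuperconductivity.HubbardSuperconductivity.Theses.ChiralWindow

/-!
# Sketch — crux-ideate stmt-HubbardSuperconductivity-10438 (CwThesis), ideator 2, round 1

Idea `mirror-twisted-descent`: first lemma(s) + the transfer target C⁺, elaboration check only
(nothing here is proved; `def … : Prop`).
-/

open scoped Matrix.Norms.L2Operator ComplexOrder MatrixOrder
open Matrix

noncomputable section

namespace Summit.HubbardSuperconductivity.HubbardSuperconductivity.Cruxes.CwThesis.MirrorTwistedDescent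

variable {n : Type*} [Fintype n] [DecidableEq n]

/-- Parity projector `P_σ = (1 + σ S)/2` of a (unitary, Hermitian) involution `S`, `σ = ±1`. -/
def parityProj (S : Matrix n n ℂ) (σ : ℤˣ) : Matrix n n ℂ :=
  (1 / 2 : ℂ) • (1 + ((σ : ℤ) : ℂ) • S)

/-- `S`-twisted (parity-resolved) Gibbs trace `tr (P e^{-βH} A)`; with `P = P_σ` and `A = 1` it is the
parity-resolved partition function `Z_σ(β) = (Z(β) + σ tr(S e^{-βH}))/2` — the second term is the
"crosscap"/partial-reflection partition function. -/
def twTrace (P H A : Matrix n n ℂ) (β : ℝ) : ℂ :=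
  (P * Matrix.gibbsWeight β H * A).trace

/-- FIRST LEMMA (finite-dimensional, provable now): **twisted-trace descent**.
`H` Hermitian, `S` a Hermitian unitary involution commuting with `H` and with the order observable
`0 ≤ A ≤ C`. Fix a parity `σ`. HYPOTHESIS (E₀-free dichotomy on traces only): EITHER the σ-twisted
Gibbs state at `β` has Rényi-2 purity `Z_σ(2β)/Z_σ(β)² ≥ 1 - η` (η < 1/2), OR the σ-subsector is
thermally empty at the ground energy, `Z_σ(β)·Z(β) < Z(2β)` (impossible when the subsector contains a
ground state, since then `Z_σ(β) ≥ e^{-βE₀} ≥ Z(2β)/Z(β)`). CONCLUSION: for every GLOBAL ground state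
`ψ` of `H` whose σ-component `P_σ ψ` is nonzero, that component has order at least the σ-twisted thermal
order minus `ηC`: `(tr(P_σe^{-βH}A)/Z_σ(β) - ηC)·‖P_σψ‖² ≤ ⟨P_σψ, A P_σψ⟩`.
(Proof sketch: purity ⇒ the top Gibbs weight in the subsector is ≥ 1-η > 1/2 ⇒ the subsector ground
level is simple; `P_σψ` is a ground vector in the subsector, hence that simple level; and
`⟨A⟩_{β,σ} ≤ p₀⟨0|A|0⟩ + (1-p₀)C`.) -/
def TwistedDescent : Prop :=
  ∀ (m : Type) [Fintype m] [DecidableEq m] (H S A : Matrix m m ℂ) (C η β : ℝ),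
    H.IsHermitian → Sᴴ = S → S * S = 1 → S * H = H * S → S * A = A * S →
    A.PosSemidef → ((C : ℂ) • (1 : Matrix m m ℂ) - A).PosSemidef → 0 < β → 0 ≤ η → η < 1 / 2 →
    ∀ σ : ℤˣ,
      ((1 - η) * (twTrace (parityProj S σ) H 1 β).re ^ 2 ≤ (twTrace (parityProj S σ) H 1 (2 * β)).re ∨
        (twTrace (parityProj S σ) H 1 β).re * (Matrix.partitionFn β H).re <
          (Matrix.partitionFn (2 * β) H).re) →
      ∀ ψ : m → ℂ, star ψ ⬝ᵥ ψ = 1 →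
        (∀ φ : m → ℂ, star φ ⬝ᵥ φ = 1 → (star ψ ⬝ᵥ H *ᵥ ψ).re ≤ (star φ ⬝ᵥ H *ᵥ φ).re) →
        parityProj S σ *ᵥ ψ ≠ 0 →
          ((twTrace (parityProj S σ) H A β).re / (twTrace (parityProj S σ) H 1 β).re - η * C) *
              (star (parityProj S σ *ᵥ ψ) ⬝ᵥ (parityProj S σ *ᵥ ψ)).re
            ≤ (star (parityProj S σ *ᵥ ψ) ⬝ᵥ A *ᵥ (parityProj S σ *ᵥ ψ)).re


/-- GENERAL FORM of the first lemma (provable now; `TwistedDescent` is the case `P = (1 ± S)/2`):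
for ANY orthogonal projection `P` commuting with `H` and `A` (an isotypic projector of any symmetry
group — parity of an involution, a momentum, a total-spin-`S` projector obtained by Haar-averaging
`SU(2)` twists, or a product of such), the same E₀-free trace dichotomy gives the same floor for the
`P`-component of every global ground state. This is the version needed when the partner channel is the
spin-triplet `E` (spin tower: resolve total spin as well). -/
def ProjectedDescent : Prop :=
  ∀ (m : Type) [Fintype m] [DecidableEq m] (H P A : Matrix m m ℂ) (C η β : ℝ),
    H.IsHermitian → Pᴴ = P → P * P = P → P * H = H * P → P * A = A * P →
    A.PosSemidef → ((C : ℂ) • (1 : Matrix m m ℂ) - A).PosSemidef → 0 < β → 0 ≤ η → η < 1 / 2 →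
    ((1 - η) * (twTrace P H 1 β).re ^ 2 ≤ (twTrace P H 1 (2 * β)).re ∨
        (twTrace P H 1 β).re * (Matrix.partitionFn β H).re < (Matrix.partitionFn (2 * β) H).re) →
    ∀ ψ : m → ℂ, star ψ ⬝ᵥ ψ = 1 →
      (∀ φ : m → ℂ, star φ ⬝ᵥ φ = 1 → (star ψ ⬝ᵥ H *ᵥ ψ).re ≤ (star φ ⬝ᵥ H *ᵥ φ).re) →
      P *ᵥ ψ ≠ 0 →
        ((twTrace P H A β).re / (twTrace P H 1 β).re - η * C) * (star (P *ᵥ ψ) ⬝ᵥ (P *ᵥ ψ)).re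
          ≤ (star (P *ᵥ ψ) ⬝ᵥ A *ᵥ (P *ᵥ ψ)).re

/-- Companion bookkeeping (provable now): an `S`-invariant observable has no matrix elements between
the two parities, so `⟨ψ, A ψ⟩ = Σ_σ ⟨P_σψ, A P_σψ⟩` and `‖ψ‖² = Σ_σ ‖P_σψ‖²`; hence the every-ground-state
floor is the minimum of the two parity floors of `TwistedDescent`. -/
def ParityDecomposition : Prop :=
  ∀ (m : Type) [Fintype m] [DecidableEq m] (S A : Matrix m m ℂ), Sᴴ = S → S * S = 1 → S * A = A * S →
    ∀ ψ : m → ℂ,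
      star ψ ⬝ᵥ A *ᵥ ψ =
          star (parityProj S 1 *ᵥ ψ) ⬝ᵥ A *ᵥ (parityProj S 1 *ᵥ ψ) +
            star (parityProj S (-1) *ᵥ ψ) ⬝ᵥ A *ᵥ (parityProj S (-1) *ᵥ ψ) ∧
        star ψ ⬝ᵥ ψ =
          star (parityProj S 1 *ᵥ ψ) ⬝ᵥ (parityProj S 1 *ᵥ ψ) +
            star (parityProj S (-1) *ᵥ ψ) ⬝ᵥ (parityProj S (-1) *ᵥ ψ)

open scoped Classical in
open Literature.MathematicalPhysics.QuantumLattice in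
/-- TRANSFER TARGET C⁺ (`ChiralTwistedTraces`, the statement the chiral engine is asked to deliver;
typed on the canonical `(N_L, S^z = 0)` occupation block of the pure torus, LogColdTorus idiom, with the
twist taken from the tree's point-group representation `fockD4 : D₄ →* U(𝓕)` (FockRelabel.lean)).
For every weak `U` there are a doping `δ_U` in the window, an INVOLUTION `γ ∈ D₄` (intended: the axis
mirror `sr 0` for a `B₂g` partner, the inversion `r 2` for an `E` partner, the diagonal mirror `sr 1`
for `A₁g` — the one involution on which `χ_{B₁g}` and the partner's character DIFFER), a temperature
slope `κ` (expected `≍ U⁻²`), a purity defect `η < 1/2`, an order floor `a > 64η` and `L₀` such that for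
every even `L ≥ L₀`, with `S` the sector block of `U_γ` (a Hermitian unitary involution commuting with
the blocks of `H = hubbardTorus 2 L 1 U` and of `P = pFᴴ pF`, by `fockD4_commute_hubbardTorus`,
`relabel_d4Perm_pairField_conjTranspose_mul`, `fockD4_mulVec_mem_szSector`), at `β = κL` each parity
`σ` satisfies the E₀-free trace dichotomy of `TwistedDescent` and, in the pure alternative, twisted
d-wave order `tr(P_σ e^{-βH} P) ≥ a L⁴ · Z_σ(β)`. -/
def ChiralTwistedTraces : Prop :=
  ∃ U₀ : ℝ, 0 < U₀ ∧ ∀ U ∈ Set.Ioo (0:ℝ) U₀, ∃ δ ∈ Set.Icc (3/10 : ℝ) (12/25), ∃ γ : DihedralGroup 4, γ * γ = 1 ∧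
    ∃ κ η a : ℝ, 0 < κ ∧ 0 ≤ η ∧ η < 1 / 2 ∧ 64 * η < a ∧ ∃ L₀ : ℕ, ∀ (L : ℕ) [NeZero L], L₀ ≤ L → Even L →
      let p : Finset (Orb (FermionTorus 2 L)) → Prop := fun s =>
        s.card = 2 * ⌊(1 - δ) * (L : ℝ) ^ 2 / 2⌋₊ ∧
          2 * (s.filter fun i => (ofLex i).2 = 0).card = 2 * ⌊(1 - δ) * (L : ℝ) ^ 2 / 2⌋₊
      let Hp := (hubbardTorus 2 L 1 U).toBlock p p
      let Ap := ((pairField dWaveFormFactor L)ᴴ * pairField dWaveFormFactor L).toBlock p p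
      let S := ((fockD4 (L := L) γ).val).toBlock p p
      ∀ σ : ℤˣ,
        ((1 - η) * (twTrace (parityProj S σ) Hp 1 (κ * L)).re ^ 2 ≤
              (twTrace (parityProj S σ) Hp 1 (2 * (κ * L))).re ∧
            a * (L : ℝ) ^ 4 * (twTrace (parityProj S σ) Hp 1 (κ * L)).re ≤
              (twTrace (parityProj S σ) Hp Ap (κ * L)).re) ∨
          (twTrace (parityProj S σ) Hp 1 (κ * L)).re * (Matrix.partitionFn (κ * L) Hp).re <
            (Matrix.partitionFn (2 * (κ * L)) Hp).re

open scoped Classical in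
open Literature.MathematicalPhysics.QuantumLattice in
/-- The intended composition (NOT a skeleton; recorded for the crux-plan stage): twisted traces +
the two finite-dimensional lemmas give UNIFORM every-ground-state d-wave coherence on the block,
`(a - 32η)·‖ψ‖²·L⁴ ≤ Re⟨ψ, pFᴴpF ψ⟩` (‖pFᴴpF‖ ≤ 32 L⁴, `pF = √2 Δ_d`), and block ↔ `IsGroundStateInSector`
bookkeeping + `UniformLROGivesSummitMatrix`-type glue then yield `ChiralWindow.CwThesis`. -/
def Composition : Prop :=
  TwistedDescent → ParityDecomposition → ChiralTwistedTraces →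
    Summit.HubbardSuperconductivity.HubbardSuperconductivity.Theses.ChiralWindow.CwThesis


/-! ## Idea B (`participation-chebyshev-ring`, imported lever): E₀-free participation-number Chebyshev -/

/-- FIRST LEMMA of idea B (finite-dimensional, provable now): for ANY Hermitian `X`, any real `c`, every
global ground state `ψ` of `H` satisfies `⟨ψ,Xψ⟩ ≥ c − √( tr((X−c)² e^{-βH}) · Z(β) / Z(2β) )`, i.e.
ground-state order ≥ thermal centre − √(thermal mean-square deviation × participation number
`N_eff = Z(β)²/Z(2β)`). Proof: `(X−c)² ⪰ 0`; an eigenbasis through `ψ` gives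
`⟨ψ,(X−c)²ψ⟩ ≤ e^{βE₀} tr((X−c)²e^{-βH})`; `e^{-βE₀} ≥ Z(2β)/Z(β)`; Cauchy–Schwarz. No symmetry, no
projector, no positivity of `X`, no commutation. -/
def ParticipationChebyshev : Prop :=
  ∀ (m : Type) [Fintype m] [DecidableEq m] (H X : Matrix m m ℂ) (c β : ℝ),
    H.IsHermitian → X.IsHermitian → 0 < β →
    ∀ ψ : m → ℂ, star ψ ⬝ᵥ ψ = 1 →
      (∀ φ : m → ℂ, star φ ⬝ᵥ φ = 1 → (star ψ ⬝ᵥ H *ᵥ ψ).re ≤ (star φ ⬝ᵥ H *ᵥ φ).re) →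
      c - Real.sqrt (((X - (c : ℂ) • 1) * (X - (c : ℂ) • 1) * Matrix.gibbsWeight β H).trace.re *
            (Matrix.partitionFn β H).re / (Matrix.partitionFn (2 * β) H).re)
        ≤ (star ψ ⬝ᵥ X *ᵥ ψ).re

open scoped Classical in
open Literature.MathematicalPhysics.QuantumLattice in
/-- TRANSFER TARGET of idea B (`RingTraces`): on the canonical block at `β = κL`, the thermal
mean-square deviation of `pFᴴpF` about a centre `cL⁴` times the participation number is at most
`(θ c L⁴)²`, `θ < 1` — then every sector ground state has `⟨pFᴴpF⟩ ≥ (1−θ)cL⁴`. -/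
def RingTraces : Prop :=
  ∃ U₀ : ℝ, 0 < U₀ ∧ ∀ U ∈ Set.Ioo (0:ℝ) U₀, ∃ δ ∈ Set.Icc (3/10 : ℝ) (12/25),
    ∃ κ c θ : ℝ, 0 < κ ∧ 0 < c ∧ 0 ≤ θ ∧ θ < 1 ∧ ∃ L₀ : ℕ, ∀ (L : ℕ) [NeZero L], L₀ ≤ L → Even L →
      let p : Finset (Orb (FermionTorus 2 L)) → Prop := fun s =>
        s.card = 2 * ⌊(1 - δ) * (L : ℝ) ^ 2 / 2⌋₊ ∧
          2 * (s.filter fun i => (ofLex i).2 = 0).card = 2 * ⌊(1 - δ) * (L : ℝ) ^ 2 / 2⌋₊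
      let Hp := (hubbardTorus 2 L 1 U).toBlock p p
      let Ap := ((pairField dWaveFormFactor L)ᴴ * pairField dWaveFormFactor L).toBlock p p
      let D := Ap - ((c * (L : ℝ) ^ 4 : ℝ) : ℂ) • 1
      (D * D * Matrix.gibbsWeight (κ * L) Hp).trace.re * (Matrix.partitionFn (κ * L) Hp).re ≤
        (θ * c * (L : ℝ) ^ 4) ^ 2 * (Matrix.partitionFn (2 * (κ * L)) Hp).re

end Summit.HubbardSuperconductivity.HubbardSuperconductivity.Cruxes.CwThesis.MirrorTwistedDescent
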